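import Mathlib
import Literature.Computability.Complexity.PNPWave0
import Literature.Computability.Complexity.Classes
import HarnessLib

/-!
# Range avoidance for local maps (`NC⁰ₖ-AVOID`) — definitions

The RANGE AVOIDANCE problem `𝒞-AVOID` [cite: RenSanthanamWang2022, §1] [cite: KuntewarSarma2025, §1
(p. 62:1–62:2)]: given a multi-output circuit `C : {0,1}ⁿ → {0,1}ᵐ` from a class `𝒞` with `m > n`,
output some `y ∈ {0,1}ᵐ` with `∀ x, C(x) ≠ y` (such `y` exist by counting; the problem is a total search
problem, and the question is the complexity of finding `y` DETERMINISTICALLY). `NC⁰ₖ` = maps each of whose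
output bits depends on at most `k` input bits [cite: KuntewarSarma2025, §1: "NC⁰ₖ is the class of circuits
with bounded fan-in which have constant depth and the output depends on at most k of the input bits"]
[cite: GuruswamiLyuWang2022, §1] [cite: GajulapalliEtAl2023, §1].

This file fixes SYNTAX ONLY (no facts): `LocalMap k n m` (per output: `k` input positions + a `2ᵏ`-entry
truth table), its semantics `eval` / `range`, the pure single-predicate sub-classes `IsPure P` used by
predicate-by-predicate analyses (monotone / symmetric / `NC⁰₂` sub-classes in [cite: KuntewarSarma2025,
Thms. 2, 8]), a string encoding `encode` (positions in unary, tables in binary — length `Θ(k·n·m)` at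
worst, so polynomial time in the input length means polynomial in `n + m` for fixed `k`), the answer
reader `readOut`, and the `Prop` "`𝒞-AVOID` restricted to instances satisfying `Q`, at stretch
`m ≥ C·n` for some absolute `C`, is solved by ONE polynomial-time function" (`LocalAvoidLinearFP`), with
polynomial time = `Literature.Computability.Complexity.IsPolyTime` (Mathlib `Turing.TM2ComputableInPolyTime`).
Printed landmarks for orientation (NOT vendored here): `NC⁰₂-AVOID ∈ FP` for `m > n`
[cite: GuruswamiLyuWang2022] [cite: KuntewarSarma2025, Thm. 2]; MONOTONE-`NC⁰₃-AVOID ∈ FP` for `m > n`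
[cite: KuntewarSarma2025, Thm. 8]; `NC⁰ₜ-AVOID ∈ FP` for `m ≥ cᵗ · n^{(t−1)/2} · log n`
[cite: GuruswamiLyuYuan2025, Thm. 1.3]; `NC⁰₃-AVOID` at `m = n + O(n^{2/3})` is rigidity-hard
[cite: GajulapalliEtAl2023, §1].
-/

namespace Literature.Computability.Complexity

open _root_.Computability

/-- A `k`-local map `{0,1}ⁿ → {0,1}ᵐ` given syntactically (an `NC⁰ₖ` circuit of the range-avoidance
literature): output `j` reads the input positions `vars j 0, …, vars j (k-1)` (repetitions allowed, so
locality `< k` is covered) and applies the truth table `table j`.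
[cite: KuntewarSarma2025, §1 (NC⁰ₖ)] [cite: GuruswamiLyuWang2022, §1] -/
structure LocalMap (k n m : ℕ) where
  /-- the `k` input positions read by each output -/
  vars : Fin m → Fin k → Fin n
  /-- the truth table of each output -/
  table : Fin m → (Fin k → Bool) → Bool

namespace LocalMap

variable {k n m : ℕ}

/-- The map `{0,1}ⁿ → {0,1}ᵐ` computed by a `k`-local description. [folklore] -/
def eval (C : LocalMap k n m) (x : Fin n → Bool) : Fin m → Bool :=
  fun j => C.table j (fun i => x (C.vars j i))

/-- Its range `Range(C) = {C(x) : x ∈ {0,1}ⁿ}`; `𝒞-AVOID` asks for a point outside it.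
[cite: RenSanthanamWang2022, §1] -/
def range (C : LocalMap k n m) : Set (Fin m → Bool) := Set.range C.eval

/-- A PURE `P`-instance: every output applies the same predicate `P` to `k` DISTINCT positions (positive
literals, fixed argument roles) — the single-predicate sub-classes of `NC⁰ₖ-AVOID` (e.g. one monotone or
one symmetric function per output, [cite: KuntewarSarma2025, §1.1 and Thm. 8]). [folklore] -/
def IsPure (P : (Fin k → Bool) → Bool) (C : LocalMap k n m) : Prop :=
  (∀ j, C.table j = P) ∧ ∀ j, Function.Injective (C.vars j)

/-- Unary code of a natural number: `a` ones and a terminating zero (self-delimiting). [folklore] -/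
def unaryCode (a : ℕ) : List Bool := List.replicate a true ++ [false]

/-- String encoding of a `k`-local description over `{0,1}`: `n` and `m` in unary, then per output its
`2ᵏ` table bits (row `p < 2ᵏ` is the input tuple `i ↦ testBit p i`) followed by its `k` positions in
unary. Injective for fixed `k`; length `Θ(m·(2ᵏ + k·n))` at worst (cf. the string conventions of
`Literature.Computability.Complexity.BoolEncodings`). [folklore] -/
def encode (C : LocalMap k n m) : List Bool :=
  unaryCode n ++ unaryCode m ++
    (List.ofFn fun j : Fin m =>
      (List.ofFn fun p : Fin (2 ^ k) => C.table j (fun i : Fin k => p.val.testBit i.val)) ++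
        (List.ofFn fun i : Fin k => unaryCode (C.vars j i).val).flatten).flatten

end LocalMap

/-- Reading an `m`-bit answer off an output string (bit `j` = list entry `j`, missing entries read as
`false`). [folklore] -/
def readOut (m : ℕ) (w : List Bool) : Fin m → Bool := fun j => w.getD j.val false

/-- **`NC⁰ₖ-AVOID`, restricted to the instances satisfying `Q`, at linear stretch, is in FP**: there are an
absolute constant `C` and ONE polynomial-time function `f` on bit-strings (`IsPolyTime`, i.e. Mathlib
`Turing.TM2ComputableInPolyTime` with the identity string encodings) such that for every `k`-local
instance `I` with `Q I`, `n ≥ 1` inputs and `m ≥ C·n` outputs, the first `m` bits of `f (encode I)` lie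
outside `Range(I)`. (The deterministic-polynomial-time reading of `𝒞-AVOID` of
[cite: RenSanthanamWang2022, §1] and [cite: KuntewarSarma2025, §1], specialised to the stretch regime
`m = Θ(n)`; the constant `C` absorbs the printed side conditions `m > n`, `m ≥ 2n`, ….) [folklore] -/
def LocalAvoidLinearFP (k : ℕ) (Q : ∀ ⦃n m : ℕ⦄, LocalMap k n m → Prop) : Prop :=
  ∃ C : ℕ, ∃ f : List Bool → List Bool, IsPolyTime f ∧
    ∀ n m (I : LocalMap k n m), Q I → 0 < n → C * n ≤ m → readOut m (f I.encode) ∉ I.range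

/-- **`NC⁰ₖ-AVOID`, restricted to the instances satisfying `Q`, at linear stretch, in deterministic time
`O(t)`**: the same reading as `LocalAvoidLinearFP` with the single solving function `f` taken from the string
function class `FTIME t` (`Literature.Computability.Complexity.FTIME`: some multi-stack machine computes `f`
within `c · t N + c` steps on inputs of length `N = |encode I|`) instead of `IsPolyTime`. Used to state
sub-exponential / quasi-polynomial rungs below the FP question, in the style of the time-bounded statements
of the range-avoidance literature ([cite: GuruswamiLyuYuan2025, §1.3 "Sub-exponential algorithms and even
smaller stretch": time `2^{n^{1-2ε/(t-3)+o(1)}}` at stretch `m ≥ n^{1+ε}`]). Note `N ≥ m ≥ C·n`, so a bound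
`2^{O(N^{α})}` with `α < 1/2` is non-trivial against the `2ⁿ·poly` enumeration for every encoding length
(`N ≤ 3nm + O(n+m)`). [folklore] -/
def LocalAvoidLinearFTIME (k : ℕ) (Q : ∀ ⦃n m : ℕ⦄, LocalMap k n m → Prop) (t : ℕ → ℕ) : Prop :=
  ∃ C : ℕ, ∃ f : List Bool → List Bool, f ∈ FTIME t ∧
    ∀ n m (I : LocalMap k n m), Q I → 0 < n → C * n ≤ m → readOut m (f I.encode) ∉ I.range

/-- The 3-bit multiplexer predicate `MUX(s; a, b) = if s then a else b` (argument roles 0; 1, 2) — one of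
the ten NPN-classes of non-degenerate 3-bit predicates. [folklore] -/
def muxPred (u : Fin 3 → Bool) : Bool := if u 0 then u 1 else u 2

/-- The 3-bit predicate `CAND(c; a, b) = c ⊕ (a ∧ b)` (argument roles 0; 1, 2) — the NPN-class of the
degree-2 "AND plus a fresh linear term" predicates. [folklore] -/
def candPred (u : Fin 3 → Bool) : Bool := xor (u 0) (u 1 && u 2)

end Literature.Computability.Complexity
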